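import Summits.ValiantsHypothesis.ValiantsHypothesis.Theorems.KPlusLogSqLawTropicalBThreeFourOrderTypeLawC7
import Summits.ValiantsHypothesis.ValiantsHypothesis.Theorems.KPlusLogSqLawTropicalBThreeFourOrderTypeLawC8

/-!
# Route «KPlusLogSqLaw», crux `TropicalB` (stmt-ValiantsHypothesis-19771) — THE WEDGE LAW of the `(3,4)` row:
# if `e₁ ≤ e₂ ≤ 2e₁` and `e₃ > max(3e₁, 2e₂)` (`e = d − d₀`, `e₁ > 0`) then `T(3,4; d) ≤ 18` — an infinite family of deficient order types

HONEST FRAMING.  Census-structure helper toward the crux `Summit.ValiantsHypothesis.ValiantsHypothesis.Theses.KPlusLogSqLaw.TropicalB` (item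
`stmt-ValiantsHypothesis-19771`, route `KPlusLogSqLaw`; cell `pub-symmetroid`, seat val-sym-trop-p5 g12, 2026-08-28; `--supports … --as helper`).
Assembly of the two wedge halves `…OrderTypeLawC7` (core order `0300 ≺ 1020 ≺ 2001`) and `…OrderTypeLawC8` (`1020 ≺ 0300 ≺ 2001`) with the tie
case; a finite statement about `3 × 3` designs with four slope classes.  Nothing here bears on `TropicalB` in its window, `WeakLifting`, the doors,
`MatrixDescartes` (stmt-ValiantsHypothesis-18050) or VP ≠ VNP.

THE LAW (`designRowD_three_four_18_wedge`).  **If `d₀ < d₁ ≤ d₂`, `d₀ + d₂ ≤ 2d₁`, `3d₁ < 2d₀ + d₃` and `2d₂ < d₀ + d₃`, then every chain of unique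
optima of a `(3,4)` design with exponents `d` at strictly increasing integer slopes with distinct consecutive terms has `n ≤ 18`** — one below
the slope count `C(6,3) − 1 = 19 = T(3,4)`.  In gap form (`eₗ = dₗ − d₀`): the class-2 gap is between one and two class-1 gaps and the class-3 gap
exceeds `3e₁` and `2e₂`.  This is an INFINITE family of order types (all `e₃` large), e.g. `(0, 2, 3, N)` for every `N ≥ 7`
(`designRowD_three_four_18_two_three`) and `(0, a, a, N)` for all `0 < a`, `3a < N` (`designRowD_three_four_18_equal_middle`): in the `K = 4`
column the first cell `(3,4)` is NOT counting-tight for these exponents although `T(3,4) = 19` is attained elsewhere (`(0,6,15,19)`,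
`census_three_four_tight_bound'`).  Proof: trichotomy on `3d₁` vs `d₀ + 2d₂` — the two strict sides are the kernel-searched cores C7 / C8
(Farkas-certificate tables, `decide +kernel`), the tie side is slope counting with one collision (`designRowD_three_four_18_of_tie`).  [this cell]
-/

set_option linter.dupNamespace false
set_option autoImplicit false

namespace Summit.ValiantsHypothesis.ValiantsHypothesis.Theorems.KPlusLogSqLaw

namespace ThreeFourCore

open Summit.ValiantsHypothesis.ValiantsHypothesis.Theorems.MatrixDescartes.Negative
open Summit.ValiantsHypothesis.ValiantsHypothesis.Theorems.LacunarySymmetroidMatrixDescartes.TropicalCensus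
open Finset

/-- **one slope collision costs one**: if two distinct class-count vectors (of class vectors `c ≠ c'` up to arrangement) have the same slope under
`d`, every unsigned dominant chain of a `(3,4)` design with exponents `d` has `n ≤ 18`. [slope counting; this cell] -/
theorem designRowD_three_four_18_of_tie (d : Fin 4 → ℕ) (c c' : Fin 3 → Fin 4) (hne : histA c ≠ histA c')
    (heq : form (histA c) d = form (histA c') d) (v ε : Fin 3 → Fin 3 → Fin 4 → ℤ) : DesignRowD d v ε 18 := by
  classical
  intro n θ p hθ hdom hne'
  by_contra hn
  push Not at hn
  obtain ⟨hsm, hsurj⟩ := ParityLaw.classSym_surjective_of_full d v ε θ p hθ hdom hne'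
    (by rw [show Nat.multichoose 4 3 = 20 by rw [Nat.multichoose_eq]; decide]; omega)
  obtain ⟨k, hk⟩ := hsurj (classSym ((1 : Equiv.Perm (Fin 3)), c))
  obtain ⟨k', hk'⟩ := hsurj (classSym ((1 : Equiv.Perm (Fin 3)), c'))
  have e1 : histA (p k).2 = histA c := histA_eq_of_classSym_eq hk
  have e2 : histA (p k').2 = histA c' := histA_eq_of_classSym_eq hk'
  have hs : Summit.ValiantsHypothesis.ValiantsHypothesis.Theorems.LacunarySymmetroidMatrixDescartes.TropicalCensus.slope d (p k) =
      Summit.ValiantsHypothesis.ValiantsHypothesis.Theorems.LacunarySymmetroidMatrixDescartes.TropicalCensus.slope d (p k') := by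
    rw [slope_eq_form, slope_eq_form, e1, e2, heq]
  have hkk : k = k' := hsm.injective hs
  apply hne
  rw [← e1, ← e2, hkk]

/-- **THE WEDGE LAW.**  `d₀ < d₁ ≤ d₂`, `d₀ + d₂ ≤ 2d₁`, `3d₁ < 2d₀ + d₃`, `2d₂ < d₀ + d₃` ⇒ the unsigned `(3,4)` row of every design with
exponents `d` is at most `18`. [this cell] -/
theorem designRowD_three_four_18_wedge (d : Fin 4 → ℕ) (h1 : d 0 < d 1) (h2 : d 1 ≤ d 2) (h3 : d 0 + d 2 ≤ 2 * d 1)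
    (h4 : 3 * d 1 < 2 * d 0 + d 3) (h5 : 2 * d 2 < d 0 + d 3) (v ε : Fin 3 → Fin 3 → Fin 4 → ℤ) : DesignRowD d v ε 18 := by
  rcases lt_trichotomy (3 * d 1) (d 0 + 2 * d 2) with hlt | heq | hgt
  · exact designRowD_three_four_18_C7 d (by omega) h3 hlt.le (by omega) hlt (by omega) v ε
  · refine designRowD_three_four_18_of_tie d ![1, 1, 1] ![2, 2, 0] (by decide) ?_ v ε
    have e1 : histA ![1, 1, 1] = ![0, 3, 0, 0] := by decide
    have e2 : histA ![2, 2, 0] = ![1, 0, 2, 0] := by decide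
    rw [e1, e2]
    simp [form, Fin.sum_univ_four]
    omega
  · exact designRowD_three_four_18_C8 d h4.le hgt.le h2 (by omega) hgt h4 v ε

/-- signed form of the wedge law. -/
theorem three_four_le_18_signed_wedge (d : Fin 4 → ℕ) (h1 : d 0 < d 1) (h2 : d 1 ≤ d 2) (h3 : d 0 + d 2 ≤ 2 * d 1)
    (h4 : 3 * d 1 < 2 * d 0 + d 3) (h5 : 2 * d 2 < d 0 + d 3) (v ε : Fin 3 → Fin 3 → Fin 4 → ℤ) (n : ℕ) (θ : Fin (n + 1) → ℤ)
    (p : Fin (n + 1) → RT) (hθ : StrictMono θ) (hdom : ∀ k, IsDominant d v ε (θ k) (p k))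
    (halt : ∀ k : Fin n, termSign ε (p k.castSucc) * termSign ε (p k.succ) < 0) : n ≤ 18 := by
  refine designRowD_three_four_18_wedge d h1 h2 h3 h4 h5 v ε n θ p hθ hdom fun k h => ?_
  have := halt k
  rw [h] at this
  exact absurd this (not_lt.mpr (mul_self_nonneg _))

/-- **the family `(0, 2, 3, N)`, `N ≥ 7`**: never counting-tight at `(3,4)`. -/
theorem designRowD_three_four_18_two_three (N : ℕ) (hN : 7 ≤ N) (v ε : Fin 3 → Fin 3 → Fin 4 → ℤ) :
    DesignRowD ![0, 2, 3, N] v ε 18 :=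
  designRowD_three_four_18_wedge _ (by simp) (by simp) (by simp) (by simp; omega) (by simp; omega) v ε

/-- **the family `(0, a, a, N)`** (two equal middle exponents), `0 < a`, `3a < N`: never counting-tight at `(3,4)`. -/
theorem designRowD_three_four_18_equal_middle (a N : ℕ) (ha : 0 < a) (hN : 3 * a < N) (v ε : Fin 3 → Fin 3 → Fin 4 → ℤ) :
    DesignRowD ![0, a, a, N] v ε 18 :=
  designRowD_three_four_18_wedge _ (by simpa using ha) (by simp) (by simp; omega) (by simp; omega) (by simp; omega) v ε

end ThreeFourCore

end Summit.ValiantsHypothesis.ValiantsHypothesis.Theorems.KPlusLogSqLaw
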